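import Summits.Ventures.CertifiedQuantumChemistry.Certificates.HubbardRingL4SectorDual
import HarnessLib

/-!
# Ventures/CertifiedQuantumChemistry — Certificates/HubbardRingL4SectorDualPoly.lean: POLYNOMIAL FAMILIES of table-form dual
# certificates for the 4-ring (`Certificates/HubbardRingL4SectorDual.lean`): the `ε`-combination of per-order data passes `check`
# when every order does (linearity of the defect tables), and a block family `S(ε)·P·S(ε)ᵀ` is positive semidefinite from
# kernel-decidable table identities (`Rz = P·Sᵀ`, `Tz m = Σ_{d₁+d₂=m} S d₁·Rz d₂`) and an exact `LDLᵀ` verdict on `P`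

HONEST FRAMING (verbatim): certified bounds for a stated model Hamiltonian in a stated basis; not a
claim about the real molecule beyond that model. A CERTIFICATE FORMAT: no model value, no row, no claim node.

Seat rdm-B (gen 44). Two generic devices used by the explicit certificate `…L4SingletDual*.lean`:
* `DualL4.polyDual ds ε` — the fieldwise combination `Σ_{m<5} ε^m · ds m` of five `Dual` records; `defΓ_polyDual`, `defγ_polyDual`,
  `def0_polyDual` (the defect tables are `ℚ`-linear in the record), hence **`check_polyDual`**: if `(ds m).check = true` for every
  `m` (five kernel `decide`s on literal data) then `(polyDual ds ε).check = true` for EVERY rational `ε` (no symbolic evaluation);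
* `DualL4.polyConv`, `DualL4.realPoly` and **`posSemidef_realPoly_of_tables`**: for integer/rational tables `S d` (`d < 3`), `P`,
  `Rz d`, `Tz m` (`m < 5`) with `P` symmetric and accepted by `ExactLDL.ldlAccept`, `Rz d = P·(S d)ᵀ` and `Tz m = Σ_{d₁+d₂=m} S d₁·Rz d₂`
  entrywise, the real matrix `Σ_m ε^m·Tz m` equals `S(ε)·P·S(ε)ᵀ` (`S(ε) = Σ_d ε^d·S d`) and is positive semidefinite for every
  real `ε` (congruence, Mathlib `PosSemidef.mul_mul_conjTranspose_same`).
0 sorry; small `def`s (`polyDual`, `polyConv`, `realPoly`, `realS`); standard axioms.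
-/

set_option linter.style.longLine false

namespace Summit.Ventures.CertifiedQuantumChemistry

namespace DualL4

open Matrix Finset
open Literature.MathematicalPhysics.QuantumLattice

/-! ## §1 Polynomial combination of `Dual` records and linearity of the defect tables -/

/-- `Σ_{m<5} ε^m · ds m`, fieldwise. -/
def polyDual (ds : Fin 5 → Dual) (ε : ℚ) : Dual where
  zD P R := ∑ m : Fin 5, ε ^ (m : ℕ) * (ds m).zD P R
  zQ P R := ∑ m : Fin 5, ε ^ (m : ℕ) * (ds m).zQ P R
  zG P R := ∑ m : Fin 5, ε ^ (m : ℕ) * (ds m).zG P R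
  nu x y τ := ∑ m : Fin 5, ε ^ (m : ℕ) * (ds m).nu x y τ
  tOne := ∑ m : Fin 5, ε ^ (m : ℕ) * (ds m).tOne
  tUp := ∑ m : Fin 5, ε ^ (m : ℕ) * (ds m).tUp
  tDn := ∑ m : Fin 5, ε ^ (m : ℕ) * (ds m).tDn
  tUU := ∑ m : Fin 5, ε ^ (m : ℕ) * (ds m).tUU
  tDD := ∑ m : Fin 5, ε ^ (m : ℕ) * (ds m).tDD
  tUD := ∑ m : Fin 5, ε ^ (m : ℕ) * (ds m).tUD
  xi := ∑ m : Fin 5, ε ^ (m : ℕ) * (ds m).xi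
  cd := ∑ m : Fin 5, ε ^ (m : ℕ) * (ds m).cd
  ch := ∑ m : Fin 5, ε ^ (m : ℕ) * (ds m).ch
  mu := ∑ m : Fin 5, ε ^ (m : ℕ) * (ds m).mu

section Linear

variable (ds : Fin 5 → Dual) (ε : ℚ)

/-- Pull an `if` with a summation-independent condition out of a weighted sum. -/
private theorem sum_mul_ite (c : Prop) [Decidable c] (f x : Fin 5 → ℚ) :
    ∑ m : Fin 5, f m * (if c then x m else 0) = if c then ∑ m : Fin 5, f m * x m else 0 := by
  split_ifs <;> simp

/-- Type-directed sum swap `Σ_{O4} Σ_{Fin 5} → Σ_{Fin 5} Σ_{O4}`. -/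
private theorem sum_comm_O4 (g : O4 → Fin 5 → ℚ) : ∑ o : O4, ∑ m : Fin 5, g o m = ∑ m : Fin 5, ∑ o : O4, g o m :=
  Finset.sum_comm
/-- Type-directed sum swap `Σ_{Fin 2} Σ_{Fin 5} → Σ_{Fin 5} Σ_{Fin 2}`. -/
private theorem sum_comm_F2 (g : Fin 2 → Fin 5 → ℚ) : ∑ τ : Fin 2, ∑ m : Fin 5, g τ m = ∑ m : Fin 5, ∑ τ : Fin 2, g τ m :=
  Finset.sum_comm
/-- Type-directed sum swap `Σ_{OP} Σ_{Fin 5} → Σ_{Fin 5} Σ_{OP}`. -/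
private theorem sum_comm_OP (g : OP → Fin 5 → ℚ) : ∑ I : OP, ∑ m : Fin 5, g I m = ∑ m : Fin 5, ∑ I : OP, g I m :=
  Finset.sum_comm

/-- The raw `Γ`-defect is linear in the record. -/
theorem defΓ_polyDual (P R : OP) : (polyDual ds ε).defΓ P R = ∑ m : Fin 5, ε ^ (m : ℕ) * (ds m).defΓ P R := by
  simp only [Dual.defΓ, polyDual, mul_sub, mul_add, Finset.sum_sub_distrib, Finset.sum_add_distrib, sum_mul_ite]

/-- The raw `γ`-defect is linear in the record. -/
theorem defγ_polyDual (x y : O4) : (polyDual ds ε).defγ x y = ∑ m : Fin 5, ε ^ (m : ℕ) * (ds m).defγ x y := by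
  have e : ∀ (τ : Fin 2) (m : Fin 5), ε ^ (m : ℕ) * ((2 - if τ = sp y then (1 : ℚ) else 0) * (ds m).nu x y τ) =
      (2 - if τ = sp y then (1 : ℚ) else 0) * (ε ^ (m : ℕ) * (ds m).nu x y τ) := by intros; ring
  simp only [Dual.defγ, polyDual, mul_sub, mul_add, mul_neg, Finset.mul_sum, Finset.sum_sub_distrib, Finset.sum_add_distrib,
    Finset.sum_neg_distrib, sum_mul_ite, sum_comm_O4, sum_comm_F2, e]

/-- The constant defect is linear in the record. -/
theorem def0_polyDual : (polyDual ds ε).def0 = ∑ m : Fin 5, ε ^ (m : ℕ) * (ds m).def0 := by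
  have e : ∀ (I J : OP) (m : Fin 5), ε ^ (m : ℕ) * ((ds m).zQ I J * Dual.qConst I J) = ε ^ (m : ℕ) * (ds m).zQ I J * Dual.qConst I J := by
    intros; ring
  simp only [Dual.def0, polyDual, mul_sub, mul_add, mul_neg, Finset.mul_sum, Finset.sum_mul, Finset.sum_sub_distrib,
    Finset.sum_add_distrib, Finset.sum_neg_distrib, sum_comm_OP, e]
  ring

/-- The canonical `Γ`-defect is linear in the record. -/
theorem cdefΓ_polyDual (P R : OP) : (polyDual ds ε).cdefΓ P R = ∑ m : Fin 5, ε ^ (m : ℕ) * (ds m).cdefΓ P R := by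
  simp only [Dual.cdefΓ, defΓ_polyDual, mul_sub, mul_add, Finset.sum_sub_distrib, Finset.sum_add_distrib]

/-- The canonical `γ`-defect is linear in the record. -/
theorem cdefγ_polyDual (x y : O4) : (polyDual ds ε).cdefγ x y = ∑ m : Fin 5, ε ^ (m : ℕ) * (ds m).cdefγ x y := by
  simp only [Dual.cdefγ, defγ_polyDual]
  split_ifs
  · rw [← Finset.sum_add_distrib]; exact Finset.sum_congr rfl fun m _ => by ring
  · simp

/-- **Per-order checks imply the check of every `ε`-combination.** -/
theorem check_polyDual (h : ∀ m : Fin 5, (ds m).check = true) (ε : ℚ) : (polyDual ds ε).check = true := by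
  have hm := fun m => (ds m).check_spec (h m)
  refine decide_eq_true ⟨?_, ?_, ?_⟩
  · intro p σ q τ r υ s φ
    rw [cdefΓ_polyDual]
    exact Finset.sum_eq_zero fun m _ => by rw [(hm m).1 p σ q τ r υ s φ, mul_zero]
  · intro p σ q τ
    rw [cdefγ_polyDual]
    exact Finset.sum_eq_zero fun m _ => by rw [(hm m).2.1 p σ q τ, mul_zero]
  · rw [def0_polyDual]
    exact Finset.sum_eq_zero fun m _ => by rw [(hm m).2.2, mul_zero]

end Linear

/-! ## §2 Block families `S(ε)·P·S(ε)ᵀ` from kernel-decidable table identities -/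

section Blocks

variable {dim r : ℕ}

/-- type-directed swap `Σ_{Fin 3} Σ_{Fin r} → Σ_{Fin r} Σ_{Fin 3}` -/
private theorem sum_comm_3r {M : Type*} [AddCommMonoid M] (g : Fin 3 → Fin r → M) :
    ∑ d : Fin 3, ∑ k : Fin r, g d k = ∑ k : Fin r, ∑ d : Fin 3, g d k := Finset.sum_comm

/-- `Σ_{d₁+d₂=m} Σ_k S d₁ a k · Rz d₂ k b` — the `ε^m` coefficient of `S(ε)·Rz(ε)` written for the kernel. -/
def polyConv (S : Fin 3 → Matrix (Fin dim) (Fin r) ℚ) (Rz : Fin 3 → Matrix (Fin r) (Fin dim) ℚ) (m : Fin 5)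
    (a b : Fin dim) : ℚ :=
  ∑ d₁ : Fin 3, ∑ d₂ : Fin 3, if (d₁ : ℕ) + d₂ = m then ∑ k : Fin r, S d₁ a k * Rz d₂ k b else 0

/-- The real matrix `Σ_{m<5} ε^m · T m`. -/
noncomputable def realPoly (T : Fin 5 → Matrix (Fin dim) (Fin dim) ℚ) (ε : ℝ) : Matrix (Fin dim) (Fin dim) ℝ :=
  ∑ m : Fin 5, (ε ^ (m : ℕ)) • (T m).map (Rat.cast : ℚ → ℝ)

/-- The real matrix `S(ε) = Σ_{d<3} ε^d · S d`. -/
noncomputable def realS (S : Fin 3 → Matrix (Fin dim) (Fin r) ℚ) (ε : ℝ) : Matrix (Fin dim) (Fin r) ℝ :=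
  ∑ d : Fin 3, (ε ^ (d : ℕ)) • (S d).map (Rat.cast : ℚ → ℝ)

/-- With `Rz d = P·(S d)ᵀ` and `T m = Σ_{d₁+d₂=m} S d₁·Rz d₂`: `Σ_m ε^m·T m = S(ε)·P·S(ε)ᵀ` over `ℝ`. -/
theorem realPoly_eq (S : Fin 3 → Matrix (Fin dim) (Fin r) ℚ) (P : Matrix (Fin r) (Fin r) ℚ)
    (Rz : Fin 3 → Matrix (Fin r) (Fin dim) ℚ) (T : Fin 5 → Matrix (Fin dim) (Fin dim) ℚ)
    (hR : ∀ (d : Fin 3) (k : Fin r) (b : Fin dim), Rz d k b = ∑ l : Fin r, P k l * S d b l)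
    (hT : ∀ (m : Fin 5) (a b : Fin dim), T m a b = polyConv S Rz m a b) (ε : ℝ) :
    realPoly T ε = realS S ε * P.map (Rat.cast : ℚ → ℝ) * (realS S ε)ᵀ := by
  ext a b
  -- both sides as Σ_{d₁,d₂} ε^(d₁+d₂) · X d₁ d₂ with X d₁ d₂ = Σ_k S d₁ a k · Rz d₂ k b
  set X : Fin 3 → Fin 3 → ℝ := fun d₁ d₂ => ∑ k : Fin r, ((S d₁ a k : ℚ) : ℝ) * ((Rz d₂ k b : ℚ) : ℝ) with hX
  have lhs : realPoly T ε a b = ∑ d₁ : Fin 3, ∑ d₂ : Fin 3, ε ^ ((d₁ : ℕ) + d₂) * X d₁ d₂ := by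
    simp only [realPoly, Matrix.sum_apply, Matrix.smul_apply, Matrix.map_apply, hT, polyConv, smul_eq_mul, hX]
    push_cast
    simp only [Fin.sum_univ_five, Fin.sum_univ_three, Fin.isValue, Fin.val_zero, Fin.val_one, Fin.val_two]
    norm_num
    ring
  have rhs : (realS S ε * P.map (Rat.cast : ℚ → ℝ) * (realS S ε)ᵀ) a b =
      ∑ d₁ : Fin 3, ∑ d₂ : Fin 3, ε ^ ((d₁ : ℕ) + d₂) * X d₁ d₂ := by
    have hXe : ∀ d₁ d₂ : Fin 3, X d₁ d₂ = ∑ k : Fin r, ∑ l : Fin r, ((S d₁ a k : ℚ) : ℝ) * (((P k l : ℚ) : ℝ) * ((S d₂ b l : ℚ) : ℝ)) := by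
      intro d₁ d₂
      simp only [hX, hR, Rat.cast_sum, Rat.cast_mul, Finset.mul_sum]
    have L1 : (realS S ε * P.map (Rat.cast : ℚ → ℝ) * (realS S ε)ᵀ) a b =
        ∑ k : Fin r, ∑ l : Fin r, realS S ε a k * ((P k l : ℚ) : ℝ) * realS S ε b l := by
      simp only [Matrix.mul_apply, Matrix.transpose_apply, Matrix.map_apply, Finset.sum_mul]
      rw [Finset.sum_comm]
    have R1 : ∑ d₁ : Fin 3, ∑ d₂ : Fin 3, ε ^ ((d₁ : ℕ) + d₂) * X d₁ d₂ =
        ∑ k : Fin r, ∑ l : Fin r, ∑ d₁ : Fin 3, ∑ d₂ : Fin 3,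
          ε ^ ((d₁ : ℕ) + d₂) * (((S d₁ a k : ℚ) : ℝ) * (((P k l : ℚ) : ℝ) * ((S d₂ b l : ℚ) : ℝ))) := by
      simp only [hXe, Finset.mul_sum, sum_comm_3r (r := r)]
    rw [L1, R1]
    refine Finset.sum_congr rfl fun k _ => Finset.sum_congr rfl fun l _ => ?_
    simp only [realS, Matrix.sum_apply, Matrix.smul_apply, Matrix.map_apply, smul_eq_mul, Fin.sum_univ_three, Fin.isValue,
      Fin.val_zero, Fin.val_one, Fin.val_two]
    ring
  rw [lhs, rhs]

/-- **A block family is positive semidefinite** once its core `P` is (exact `LDLᵀ` verdict) and the shipped tables satisfy the two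
kernel identities. -/
theorem posSemidef_realPoly_of_tables (S : Fin 3 → Matrix (Fin dim) (Fin r) ℚ) (P : Matrix (Fin r) (Fin r) ℚ)
    (Rz : Fin 3 → Matrix (Fin r) (Fin dim) ℚ) (T : Fin 5 → Matrix (Fin dim) (Fin dim) ℚ)
    (hsymm : ∀ k l : Fin r, P k l = P l k) (hacc : ExactLDL.ldlAccept r P = true)
    (hR : ∀ (d : Fin 3) (k : Fin r) (b : Fin dim), Rz d k b = ∑ l : Fin r, P k l * S d b l)
    (hT : ∀ (m : Fin 5) (a b : Fin dim), T m a b = polyConv S Rz m a b) (ε : ℝ) :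
    (realPoly T ε).PosSemidef := by
  have hPs : P.IsSymm := Matrix.IsSymm.ext fun k l => hsymm l k
  have hP : (P.map (Rat.cast : ℚ → ℝ)).PosSemidef := (ExactLDL.ldlAccept_iff_posSemidef_real P hPs).mp hacc
  rw [realPoly_eq S P Rz T hR hT ε]
  have h := hP.mul_mul_conjTranspose_same (realS S ε)
  rwa [Matrix.conjTranspose_eq_transpose_of_trivial] at h

end Blocks

end DualL4

end Summit.Ventures.CertifiedQuantumChemistry
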